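import Literature.Analysis.FluidPDE.BiotSavartNewtonKernel
import Literature.Analysis.FluidPDE.HelmholtzAnnihilator
import Literature.Analysis.FluidPDE.NewtonPotentialRepresentation
import HarnessLib

/-!
# The Newtonian potential of a smooth compactly supported source on `ℝ³`

Analysis/FluidPDE support file (theorems only) in the decomposition of the named fact
`Literature.Analysis.FluidPDE.leray_solution_ckn_decay` (Kang–Miura–Tsai 2021, Lemmas 3.3–3.4)
through the slice oscillation estimate of `LerayPressureDecayReduction.lean`. The near-field
part of the local pressure expansion of a (mollified) local Leray solution is the Newtonian
potential of the smooth compactly supported source `s = -∑ᵢⱼ ∂ᵢ∂ⱼ(ψ Fᵢⱼ)`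
(Kang–Miura–Tsai, IMRN 2021 = arXiv:1812.10509, App. 1 p. 18:
`p^ε(x,t) = ∫ (4π|x-y|)⁻¹ ∇·G_ε(y,t) dy = -⅓φ_ε|v|² + ∫ K(x-y) : (φ_ε v ⊗ v)(y,t) dy`). This file
collects the classical calculus of the potential

  `N[s] := s ⋆ Γ`,  `N[s](x) = ∫ s(t) Γ(x - t) dt`,  `Γ(z) = -(4π|z|)⁻¹` (`newtonKernel`),

realised as Mathlib's convolution `s ⋆[lsmul ℝ ℝ, volume] newtonKernel` with the smooth factor
on the left (Gilbarg–Trudinger, (2.17)–(2.18), Lemma 4.1–4.2):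

* `contDiff_convolution_newtonKernel` — `N[s] ∈ C^∞` for `s ∈ C^∞_c`;
* `fderiv_convolution_newtonKernel_apply` — `∂ᵥ N[s] = N[∂ᵥ s]`;
* `laplacian_convolution_newtonKernel` — **Poisson's equation** `Δ N[s] = s` (from the tree's
  Green representation `BiotSavartNewtonKernel.integral_newtonKernel_mul_laplacian`);
* `exists_forall_abs_convolution_newtonKernel_le` — **a uniform bound**
  `|N[φ](y)| ≤ K(R, S)` for all `y`, all centres `c` and all continuous `φ` with
  `supp φ ⊆ B̄(c, R)`, `|φ| ≤ S` (split `|Γ| ≤ (4π)⁻¹(1_{|z|<1}|z|⁻² + 1)`);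
* `integral_convolution_newtonKernel_mul` — **symmetry (duality)**
  `∫ N[s] μ = ∫ s N[μ]` for `s, μ ∈ C_c` (Fubini after truncating `Γ` to a large ball, which
  changes neither side).

## Mathlib / tree search

Tree: `newtonKernel`, `abs_newtonKernel` (`NewtonKernel.lean`),
`NewtonPotentialRepresentation.locallyIntegrable_newtonKernel`,
`integral_newtonKernel_mul_laplacian`, `integrable_newtonKernel_mul`, `convolution_lsmul_apply`
(`BiotSavartNewtonKernel`, `NormalisedPressureL2Bound`), `fderiv_convolution_lsmul_apply`,
`laplacian_convolution_lsmul`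
(`HelmholtzAnnihilator.lean`), `nearProfile₂`, `nearProfile₁_le`, `integrable_nearProfile₂_norm`,
`integral_nearProfile₂_norm_eq` (`TaoEnergyLocalisationPressure`, `NormalisedPressureL2Bound`).
Mathlib: `HasCompactSupport.contDiff_convolution_left`, `Integrable.convolution_integrand`,
`integral_integral_swap`, `Measure.addHaar_closedBall_center`.

## References

* D. Gilbarg, N. S. Trudinger, *Elliptic partial differential equations of second order*
  (2001), (2.17)–(2.18), Lemmas 4.1–4.2. [GilbargTrudinger2001]
* K. Kang, H. Miura, T.-P. Tsai, IMRN 2021 = arXiv:1812.10509, App. 1, proof of Lemma 3.4,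
  p. 18. [KangMiuraTsai2020]
-/

noncomputable section

open MeasureTheory Set Filter Topology Function Metric ContinuousLinearMap
open scoped ENNReal NNReal Convolution ContDiff Laplacian

namespace Literature.Analysis.FluidPDE

section Potential

variable {s μ : EuclideanSpace ℝ (Fin 3) → ℝ}

/-- `Γ` is even: `Γ(-z) = Γ(z)`. [folklore] -/
theorem newtonKernel_neg (z : EuclideanSpace ℝ (Fin 3)) : newtonKernel (-z) = newtonKernel z := by
  rw [newtonKernel_eq, newtonKernel_eq, norm_neg]

/-- Unfolding the potential with the kernel first: `N[s](x) = ∫ Γ(x - t) s(t) dt` (the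
source-first unfolding `N[s](x) = ∫ s(t) Γ(x - t) dt` is `convolution_lsmul_apply s newtonKernel x`,
`NormalisedPressureL2Bound.lean`). [folklore] -/
theorem convolution_newtonKernel_apply' (s : EuclideanSpace ℝ (Fin 3) → ℝ)
    (x : EuclideanSpace ℝ (Fin 3)) :
    (s ⋆[lsmul ℝ ℝ, volume] newtonKernel) x = ∫ t, newtonKernel (x - t) * s t := by
  rw [convolution_lsmul_apply]
  exact integral_congr_ae (Eventually.of_forall fun t => mul_comm _ _)

/-- **Smoothness**: `N[s] ∈ C^∞(ℝ³)` for `s ∈ C^∞_c(ℝ³)` (the smooth compactly supported factor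
of the convolution carries all derivatives; `Γ ∈ L¹_loc`). [cite: GilbargTrudinger2001, Lemma 4.1] -/
theorem contDiff_convolution_newtonKernel (hs : ContDiff ℝ ∞ s) (hsc : HasCompactSupport s) :
    ContDiff ℝ ∞ (s ⋆[lsmul ℝ ℝ, volume] newtonKernel) :=
  hsc.contDiff_convolution_left _ hs NewtonPotentialRepresentation.locallyIntegrable_newtonKernel

/-- **Derivatives fall on the source**: `∂ᵥ N[s](x) = N[∂ᵥ s](x)` for `s ∈ C¹_c`.
[cite: GilbargTrudinger2001, Lemma 4.1] -/
theorem fderiv_convolution_newtonKernel_apply (hs : ContDiff ℝ 1 s) (hsc : HasCompactSupport s)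
    (x v : EuclideanSpace ℝ (Fin 3)) :
    fderiv ℝ (s ⋆[lsmul ℝ ℝ, volume] newtonKernel) x v =
      ((fun t => fderiv ℝ s t v) ⋆[lsmul ℝ ℝ, volume] newtonKernel) x :=
  fderiv_convolution_lsmul_apply hs hsc
    NewtonPotentialRepresentation.locallyIntegrable_newtonKernel x v

/-- **Poisson's equation for the Newtonian potential**: `Δ N[s] = s` pointwise, for
`s ∈ C²_c(ℝ³)` (`Δ(s ⋆ Γ) = (Δs) ⋆ Γ` and Green's representation `∫ Γ(x-t) Δs(t) dt = s(x)`).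
[cite: GilbargTrudinger2001, (2.17)–(2.18) and Lemma 4.2] -/
theorem laplacian_convolution_newtonKernel (hs : ContDiff ℝ 2 s) (hsc : HasCompactSupport s)
    (x : EuclideanSpace ℝ (Fin 3)) :
    (Δ (s ⋆[lsmul ℝ ℝ, volume] newtonKernel)) x = s x := by
  rw [laplacian_convolution_lsmul hs hsc
    NewtonPotentialRepresentation.locallyIntegrable_newtonKernel x, convolution_newtonKernel_apply']
  exact integral_newtonKernel_mul_laplacian hs hsc x

/-! ### A uniform bound -/

/-- **A radial majorant of `Γ`**: `|Γ(z)| ≤ (4π)⁻¹ (1_{|z|<1}|z|⁻² + 1)` for all `z`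
(`|Γ(z)| = (4π|z|)⁻¹`; for `|z| < 1`, `|z|⁻¹ ≤ |z|⁻²`; for `|z| ≥ 1`, `|z|⁻¹ ≤ 1`). [folklore] -/
theorem abs_newtonKernel_le_nearProfile₂_add_one (z : EuclideanSpace ℝ (Fin 3)) :
    |newtonKernel z| ≤ (4 * Real.pi)⁻¹ * (nearProfile₂ 1 ‖z‖ + 1) := by
  rw [abs_newtonKernel, mul_inv]
  refine mul_le_mul_of_nonneg_left ?_ (by positivity)
  have h2 : 0 ≤ nearProfile₂ 1 ‖z‖ := nearProfile₂_nonneg _ _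
  by_cases hz : ‖z‖ < 1
  · have h1 : nearProfile₁ 1 ‖z‖ = ‖z‖⁻¹ := if_pos hz
    rw [← h1]
    exact (nearProfile₁_le 1 (norm_nonneg z)).trans (by rw [one_mul]; linarith)
  · rw [not_lt] at hz
    have : ‖z‖⁻¹ ≤ 1 := inv_le_one_of_one_le₀ hz
    linarith

/-- **A bound for `N[φ]` uniform in the point and in the centre of the support.** For every
radius `R` and height `S` there is `K` such that for every continuous `φ` supported in a closed
ball `B̄(c, R)` (any centre `c`) with `|φ| ≤ S`, `|N[φ](y)| ≤ K` for every `y`: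
`|N[φ](y)| ≤ S ∫_{B̄(c,R)} |Γ(y-t)| dt ≤ (4π)⁻¹ S (∫ 1_{|z|<1}|z|⁻² dz + |B̄_R|) = (4π)⁻¹ S (4π + |B̄_R|)`.
[folklore] -/
theorem exists_forall_abs_convolution_newtonKernel_le (R S : ℝ) :
    ∃ K : ℝ, ∀ (φ : EuclideanSpace ℝ (Fin 3) → ℝ) (c : EuclideanSpace ℝ (Fin 3)),
      Continuous φ → HasCompactSupport φ → tsupport φ ⊆ closedBall c R → (∀ t, |φ t| ≤ S) →
        ∀ y, |(φ ⋆[lsmul ℝ ℝ, volume] newtonKernel) y| ≤ K := by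
  set S' : ℝ := max S 0 with hS'
  have hS'0 : 0 ≤ S' := le_max_right _ _
  set V : ℝ := (volume : Measure (EuclideanSpace ℝ (Fin 3))).real (closedBall 0 R) with hV
  refine ⟨S' * (4 * Real.pi)⁻¹ * (4 * Real.pi * 1 + V), fun φ c hφ hφc hsupp hφS y => ?_⟩
  have hφS' : ∀ t, |φ t| ≤ S' := fun t => (hφS t).trans (le_max_left _ _)
  -- the majorant
  set m : EuclideanSpace ℝ (Fin 3) → ℝ := fun t =>
    S' * (4 * Real.pi)⁻¹ * (nearProfile₂ 1 ‖y - t‖ + (closedBall c R).indicator (fun _ => (1 : ℝ)) t)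
    with hm
  have hpt : ∀ t, |φ t * newtonKernel (y - t)| ≤ m t := by
    intro t
    rw [abs_mul]
    have hn : 0 ≤ nearProfile₂ 1 ‖y - t‖ := nearProfile₂_nonneg _ _
    by_cases ht : t ∈ closedBall c R
    · rw [hm]
      dsimp only
      rw [indicator_of_mem ht]
      calc |φ t| * |newtonKernel (y - t)|
          ≤ S' * ((4 * Real.pi)⁻¹ * (nearProfile₂ 1 ‖y - t‖ + 1)) :=
            mul_le_mul (hφS' t) (abs_newtonKernel_le_nearProfile₂_add_one _) (abs_nonneg _) hS'0
        _ = S' * (4 * Real.pi)⁻¹ * (nearProfile₂ 1 ‖y - t‖ + 1) := by ring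
    · have h0 : φ t = 0 := image_eq_zero_of_notMem_tsupport fun h => ht (hsupp h)
      rw [h0, abs_zero, zero_mul, hm]
      dsimp only
      rw [indicator_of_notMem ht, add_zero]
      positivity
  -- integrability of the majorant and of the integrand
  have hmi : Integrable m := by
    refine Integrable.const_mul (Integrable.add ?_ ?_) _
    · exact (integrable_nearProfile₂_norm one_pos).comp_sub_left y
    · exact (integrableOn_const measure_closedBall_lt_top.ne).integrable_indicator
        measurableSet_closedBall
  have hint : Integrable fun t => φ t * newtonKernel (y - t) := by
    have := integrable_newtonKernel_mul hφ hφc y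
    exact this.congr (Eventually.of_forall fun t => mul_comm _ _)
  -- integrate
  rw [convolution_lsmul_apply]
  calc |∫ t, φ t * newtonKernel (y - t)| ≤ ∫ t, |φ t * newtonKernel (y - t)| :=
        abs_integral_le_integral_abs
    _ ≤ ∫ t, m t := integral_mono hint.abs hmi hpt
    _ = S' * (4 * Real.pi)⁻¹ * ((∫ t, nearProfile₂ 1 ‖y - t‖) +
          ∫ t, (closedBall c R).indicator (fun _ => (1 : ℝ)) t) := by
        rw [hm, integral_const_mul, integral_add]
        · exact (integrable_nearProfile₂_norm one_pos).comp_sub_left y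
        · exact (integrableOn_const measure_closedBall_lt_top.ne).integrable_indicator
            measurableSet_closedBall
    _ = S' * (4 * Real.pi)⁻¹ * (4 * Real.pi * 1 + V) := by
        congr 2
        · rw [integral_sub_left_eq_self (fun z : EuclideanSpace ℝ (Fin 3) => nearProfile₂ 1 ‖z‖)
            volume y]
          exact integral_nearProfile₂_norm_eq one_pos
        · rw [integral_indicator measurableSet_closedBall, setIntegral_const, smul_eq_mul, mul_one,
            hV, Measure.real, Measure.real, Measure.addHaar_closedBall_center]

/-! ### Symmetry (duality) -/

/-- **Symmetry of the Newtonian potential against test densities**: for continuous compactly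
supported `s`, `μ`, `∫ N[s](x) μ(x) dx = ∫ s(t) N[μ](t) dt`
(`= ∫∫ s(t) Γ(x - t) μ(x)`, Fubini; the kernel may be truncated to a large ball without changing
either side, which makes the double integrand integrable). [cite: GilbargTrudinger2001, Lemma 4.1] -/
theorem integral_convolution_newtonKernel_mul (hs : Continuous s) (hsc : HasCompactSupport s)
    (hμ : Continuous μ) (hμc : HasCompactSupport μ) :
    ∫ x, (s ⋆[lsmul ℝ ℝ, volume] newtonKernel) x * μ x =
      ∫ t, s t * (μ ⋆[lsmul ℝ ℝ, volume] newtonKernel) t := by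
  obtain ⟨Rs, hRs⟩ : ∃ R : ℝ, tsupport s ⊆ closedBall (0 : EuclideanSpace ℝ (Fin 3)) R :=
    (hsc.isCompact.isBounded).subset_closedBall 0
  obtain ⟨Rμ, hRμ⟩ : ∃ R : ℝ, tsupport μ ⊆ closedBall (0 : EuclideanSpace ℝ (Fin 3)) R :=
    (hμc.isCompact.isBounded).subset_closedBall 0
  set L : ℝ := |Rs| + |Rμ| + 1 with hL
  set ΓL : EuclideanSpace ℝ (Fin 3) → ℝ := (closedBall (0 : EuclideanSpace ℝ (Fin 3)) L).indicator
    newtonKernel with hΓL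
  have hΓLi : Integrable ΓL :=
    (NewtonPotentialRepresentation.locallyIntegrable_newtonKernel.integrableOn_isCompact
      (isCompact_closedBall 0 L)).integrable_indicator measurableSet_closedBall
  -- the truncation changes nothing on the supports
  have htrunc : ∀ x t, s t * newtonKernel (x - t) * μ x = s t * ΓL (x - t) * μ x := by
    intro x t
    by_cases hst : s t = 0
    · rw [hst, zero_mul, zero_mul, zero_mul, zero_mul]
    by_cases hμx : μ x = 0
    · rw [hμx, mul_zero, mul_zero]
    have ht : ‖t‖ ≤ |Rs| :=
      (mem_closedBall_zero_iff.1 (hRs (subset_tsupport _ hst))).trans (le_abs_self _)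
    have hx : ‖x‖ ≤ |Rμ| :=
      (mem_closedBall_zero_iff.1 (hRμ (subset_tsupport _ hμx))).trans (le_abs_self _)
    have hmem : x - t ∈ closedBall (0 : EuclideanSpace ℝ (Fin 3)) L := by
      rw [mem_closedBall_zero_iff]
      calc ‖x - t‖ ≤ ‖x‖ + ‖t‖ := norm_sub_le _ _
        _ ≤ L := by rw [hL]; linarith
    rw [hΓL, indicator_of_mem hmem]
  -- integrability of the truncated double integrand
  obtain ⟨M, hM⟩ := hμ.bounded_above_of_compact_support hμc
  have hHL : Integrable (uncurry fun (x t : EuclideanSpace ℝ (Fin 3)) => s t * ΓL (x - t) * μ x)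
      ((volume : Measure (EuclideanSpace ℝ (Fin 3))).prod volume) := by
    have h1 : Integrable (fun p : EuclideanSpace ℝ (Fin 3) × EuclideanSpace ℝ (Fin 3) =>
        (lsmul ℝ ℝ) (s p.2) (ΓL (p.1 - p.2))) ((volume : Measure (EuclideanSpace ℝ (Fin 3))).prod
          volume) :=
      (hs.integrable_of_hasCompactSupport hsc).convolution_integrand (lsmul ℝ ℝ) hΓLi
    have h2 : Integrable (fun p : EuclideanSpace ℝ (Fin 3) × EuclideanSpace ℝ (Fin 3) =>
        (s p.2 * ΓL (p.1 - p.2)) * μ p.1) ((volume : Measure (EuclideanSpace ℝ (Fin 3))).prod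
          volume) :=
      h1.mul_bdd (hμ.comp continuous_fst).aestronglyMeasurable
        (Eventually.of_forall fun p => hM p.1)
    exact h2
  -- compute
  calc ∫ x, (s ⋆[lsmul ℝ ℝ, volume] newtonKernel) x * μ x
      = ∫ x, ∫ t, s t * newtonKernel (x - t) * μ x := by
        refine integral_congr_ae (Eventually.of_forall fun x => ?_)
        dsimp only
        rw [convolution_lsmul_apply, ← integral_mul_const]
    _ = ∫ x, ∫ t, s t * ΓL (x - t) * μ x := by simp_rw [htrunc]
    _ = ∫ t, ∫ x, s t * ΓL (x - t) * μ x := integral_integral_swap hHL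
    _ = ∫ t, ∫ x, s t * newtonKernel (x - t) * μ x := by simp_rw [htrunc]
    _ = ∫ t, s t * (μ ⋆[lsmul ℝ ℝ, volume] newtonKernel) t := by
        refine integral_congr_ae (Eventually.of_forall fun t => ?_)
        dsimp only
        rw [convolution_lsmul_apply, ← integral_const_mul]
        refine integral_congr_ae (Eventually.of_forall fun x => ?_)
        dsimp only
        rw [← newtonKernel_neg (t - x), neg_sub]
        ring

end Potential

end Literature.Analysis.FluidPDE
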